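import Summits.QuantumFields.YangMills.Theorems.VirialFluxGapSectorWeightSmooth
import HarnessLib

/-!
# Route `VirialFluxGap` (YangMills): the support item `LogSectorWeightConvex` (stmt-QuantumFields-24182) holds BY NAME

LOG-CONVEXITY of every electric-flux sector weight in the coupling: for every spatial torus `(ℤ/L)³`, ring length `n+1`
and seam twist `z ∈ (ℤ/2)³`, `b ↦ log W_z(b)`, `W_z(b) = TT.sectorWeight b n z 1`, is convex on `ℝ`.

Mechanism: by the landed one-exponential form ✓`TT.SectorSmooth.sectorWeight_one_eq_integral_exp` (w3 g35, p703259),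
`W_z(b) = ∫ exp(b·Φ_z) dν` over the finite product measure `slices ⊗ seam field` with `Φ_z` bounded measurable
(✓`measurable_sectorExponent`, ✓`exists_abs_sectorExponent_le`); so `log W_z = cgf Φ_z ν` is Mathlib's CUMULANT GENERATING
FUNCTION of a bounded variable, whose domain of finiteness is all of `ℝ`; Mathlib gives analyticity (`analyticAt_cgf`) and
the variance formula `cgf'' (v) = ∫ (Φ − cgf'(v))² e^{vΦ} dν / mgf(v) ≥ 0` (`iteratedDeriv_two_cgf_eq_integral`), and
`convexOn_univ_of_deriv2_nonneg` concludes (§1, generic lemma `convexOn_cgf_of_bounded`; §2 the sector weights; §3 the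
item by name).

HONEST FRAMING: a calculus support of LINE g14-A (planner ym-idea-4 g14; glued split of crux `TwistedEquipartition`
stmt-QuantumFields-24142); the crux `SharpTwistedLaplace` (stmt-QuantumFields-24204) and `PeriodicSoftness` (24141) are
OPEN; no rung / summit statement is proved; the Yang–Mills mass gap is NOT proved.  THEOREMS ONLY (0 `def`, 0 `sorry`),
standard axioms.  References: [cite: MontvayMunster1994, (3.145)]; [cite: Griffiths1964].
-/

set_option autoImplicit false

noncomputable section

open MeasureTheory Filter Set Function ProbabilityTheory
open scoped BigOperators Topology
open Literature.MathematicalPhysics.QuantumFieldTheory hiding SU2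

namespace Summit.QuantumFields.YangMills.Theorems.FemtoTransferGap.TT.SectorSmooth

open Summit.QuantumFields.YangMills.Theorems.FemtoTransferGap
open Summit.QuantumFields.YangMills.Theorems.FemtoTransferGap.TT

/-! ## §1 The cumulant generating function of a bounded variable is convex on `ℝ` -/

section Cgf

variable {Ω : Type*} [MeasurableSpace Ω] (ν : Measure Ω) [IsFiniteMeasure ν] {Φ : Ω → ℝ} {B : ℝ}

/-- For bounded measurable `Φ` on a finite measure, every real `t` lies in the interior of the domain of finiteness of
the moment generating function (`integrableExpSet Φ ν = ℝ`). [folklore] -/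
theorem mem_interior_integrableExpSet_of_bounded (hΦ : Measurable Φ) (hB : ∀ ω, |Φ ω| ≤ B) (t : ℝ) :
    t ∈ interior (integrableExpSet Φ ν) := by
  have hint : ∀ s : ℝ, Integrable (fun ω => Real.exp (s * Φ ω)) ν := fun s =>
    Integrable.of_bound ((measurable_const.mul hΦ).exp).aestronglyMeasurable (Real.exp (|s| * B))
      (ae_of_all _ fun ω => by
        rw [Real.norm_eq_abs, Real.abs_exp]
        refine Real.exp_le_exp.2 ?_
        have h1 : |s * Φ ω| ≤ |s| * B := by
          rw [abs_mul]; exact mul_le_mul_of_nonneg_left (hB ω) (abs_nonneg _)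
        exact (le_abs_self _).trans h1)
  have huniv : integrableExpSet Φ ν = univ := Set.eq_univ_of_forall fun s => hint s
  rw [huniv, interior_univ]
  exact Set.mem_univ t

/-- ★ **The cumulant generating function `t ↦ log ∫ e^{tΦ} dν` of a bounded measurable `Φ` on a finite measure is convex
on `ℝ`** (Hölder / variance formula: `cgf'' = Var_tilted ≥ 0`). [cite: Griffiths1964] -/
theorem convexOn_cgf_of_bounded (hΦ : Measurable Φ) (hB : ∀ ω, |Φ ω| ≤ B) :
    ConvexOn ℝ univ (cgf Φ ν) := by
  have hmem := mem_interior_integrableExpSet_of_bounded ν hΦ hB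
  have hanal : ∀ v : ℝ, AnalyticAt ℝ (cgf Φ ν) v := fun v => analyticAt_cgf (hmem v)
  have hdiff : Differentiable ℝ (cgf Φ ν) := fun v => (hanal v).differentiableAt
  have hdiff2 : Differentiable ℝ (deriv (cgf Φ ν)) := fun v => (hanal v).deriv.differentiableAt
  refine convexOn_univ_of_deriv2_nonneg hdiff hdiff2 fun v => ?_
  rw [← iteratedDeriv_eq_iterate, iteratedDeriv_two_cgf_eq_integral (hmem v)]
  exact div_nonneg (integral_nonneg fun ω => mul_nonneg (sq_nonneg _) (Real.exp_pos _).le) (mgf_nonneg)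

end Cgf

/-! ## §2 The sector weights: `log W_z` is a cumulant generating function, hence convex -/

section Sector

variable {L : ℕ} [NeZero L]

/-- `log W_z(b) = cgf Φ_z ν (b)`: the logarithm of the sector weight is the cumulant generating function of the bounded
exponent `Φ_z = log(∏ K_1 · K_1(seam))` under `ν = slices ⊗ seam field`. [cite: MontvayMunster1994, (3.145)] -/
theorem log_sectorWeight_one_eq_cgf (n : ℕ) (z : Fin 3 → Bool) :
    (fun b : ℝ => Real.log (sectorWeight (L := L) b n z (fun _ _ => (1 : ℝ)))) =
      cgf (fun p : (Fin (n + 1) → GaugeConfig 3 L SU2) × (Site 3 L → SU2) =>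
          Real.log ((∏ i : Fin n, transferKernel su2Rep 1 (p.1 i.castSucc) (p.1 i.succ)) *
            transferKernel su2Rep 1 (p.1 (Fin.last n)) (gaugeTransform p.2 (twist3 z (p.1 0)))))
        ((Measure.pi fun _ : Fin (n + 1) => configMeasure SU2 L).prod (gaugeMeasure L)) := by
  funext b
  rw [sectorWeight_one_eq_integral_exp b n z]
  simp only [cgf, mgf]

/-- ★★ **`b ↦ log W_z(b)` is convex on `ℝ`** for every `L`, `n`, `z`. [cite: MontvayMunster1994, (3.145)] [cite: Griffiths1964] -/
theorem convexOn_log_sectorWeight_one (n : ℕ) (z : Fin 3 → Bool) :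
    ConvexOn ℝ univ (fun b : ℝ => Real.log (sectorWeight (L := L) b n z (fun _ _ => (1 : ℝ)))) := by
  haveI := isProbabilityMeasure_gaugeMeasure (L := L)
  obtain ⟨B, hB⟩ := exists_abs_sectorExponent_le (L := L) n z
  rw [log_sectorWeight_one_eq_cgf n z]
  exact convexOn_cgf_of_bounded _ (measurable_sectorExponent (L := L) n z) hB

end Sector

end Summit.QuantumFields.YangMills.Theorems.FemtoTransferGap.TT.SectorSmooth

/-! ## §3 The item, by name -/

namespace Summit.QuantumFields.YangMills.Theorems

open Summit.QuantumFields.YangMills.Theorems.FemtoTransferGap.TT.SectorSmooth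

/-- ★★ **`LogSectorWeightConvex` holds** (item stmt-QuantumFields-24182 of route `VirialFluxGap`, BY NAME): for every `L`,
`n`, `z` the map `b ↦ log (TT.sectorWeight b n z 1)` is convex on `ℝ`.  No crux / rung / summit is proved; the YM mass
gap is NOT proved. [cite: MontvayMunster1994, (3.145)] [cite: Griffiths1964] -/
theorem virialFluxGap_logSectorWeightConvex_proof :
    Summit.QuantumFields.YangMills.Theses.VirialFluxGap.LogSectorWeightConvex := by
  intro L _ n z
  exact convexOn_log_sectorWeight_one n z

end Summit.QuantumFields.YangMills.Theorems

end
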